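import Summits.CriticalPhenomena.SAWScalingLimit.Theorems.SAWDefectDecoherenceObservableToSLERClassZeroAudit
import HarnessLib

/-!
# Good gates EXIST at small locality scale: non-vacuity of the r3 gate vocabulary
(line `six-class-type-ladder`, crux `SAWDevelopingMap.ObservableToSLE`, stmt-CriticalPhenomena-10472)

Landing target:
`Summits/CriticalPhenomena/SAWScalingLimit/Theorems/SAWDevelopingMapObservableToSLETypeLadderGateNonVacuity.lean`
(`--supports stmt-CriticalPhenomena-10472`, in support of stub S1 `stub_nestedRenewalFatCoR` of the
lead's skeleton r3; registered helper `goodGate_nonvacuous`).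

The companion negative certificate `TypeLadder.not_wideEscape_of_subset_ball` /
`TypeLadder.stub_not_nestedRenewalP` (landed) shows that in a domain `Ω ⊆ 𝔻` with rescaled root of
norm `< 2` NO `ρ/4`-wide escape reaches distance `2R` once `R ≥ 2`, so the abundance input must bound
the locality scale.  This file certifies, by an explicit witness, that the SAME vocabulary is
satisfiable once `R` is small: in the unit disc `𝔻 = ball 0 1`, at mesh `δ = 1/10`, window radius
`ρ = 1/10` and locality scale `R = 1/5`, the vertical class-zero gate edge `(p, q) = ((0, 1), (e₁, 0))`
(root `c := p`, removed set `S :=` the lower half-lattice `{rowOf 0 · ≤ rowOf 0 p}` cut down to the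
window ball) carries

* a clean flat `ρ`-window (`HasCleanWindow`, orientation `k = 0`; the window clause holds by the very
  definition of `S`, the gate identity `rowOf 0 q = rowOf 0 p + 1` by `rowOf_zero`);
* a `ρ/4`-wide escape (`WideEscape`): the vertical segment from `δ c_q + i/10` to `δ c_q + 2i/5`, whose
  closed `ρ/4`-balls stay in `𝔻` and `ρ/4`-above every rescaled vertex of the lower half-lattice;
* hence a FIRST GOOD GATE (`IsFirstGoodGateN`) of the two-step list `[p, q]` at level `0` of the
  constant family `fun _ => S`, with `S ∋ c` inside the closed `R`-ball about the rescaled root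
  (the locality clause of `TameNestedFamily`).

Main statement: `goodGate_nonvacuous` (registered helper); the literal forms (A) `wideEscape_nonvacuous`
and (B) `cleanWindow_wideEscape_nonvacuous` of the lead's brief are corollaries.
Not attempted here: the full `TameNestedFamily` package (lattice connectivity and the `hexBall`
presentation of `S`).
-/

noncomputable section

open scoped BigOperators Topology NNReal ENNReal Classical
open Filter Set MeasureTheory Metric
open Literature.Probability.LatticeModels (HexVertex hexGraph hexCenter Site
  hexGraph_adj_iff_of_snd_eq_zero_holds)
open Literature.Probability.Percolation (hexCenter_re hexCenter_im)
open Literature.Probability.RandomPlanarGeometry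
open Literature.Probability.RandomPlanarGeometry.SAW

namespace Summit.CriticalPhenomena.SAWScalingLimit.Theorems.ObservableToSLE.TypeLadder

open Summit.CriticalPhenomena.SAWScalingLimit.Theorems.ObservableToSLER.BridgeGate
open Summit.CriticalPhenomena.SAWScalingLimit.Theorems.ObservableToSLER.NestedGate

/-! ### The gate edge of the witness: root `p = (0, 1)` (down-face), gate vertex `q = (e₁, 0)` (up-face) -/

/-- The gate vertex `(e₁, 0)` is one class-`0` row above the root `(0, 1)`. [folklore] -/
theorem rowOf_gate_eq :
    rowOf 0 ((Pi.single 1 1, 0) : HexVertex) = rowOf 0 ((0, 1) : HexVertex) + 1 := by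
  rw [rowOf_zero, rowOf_zero]; simp

/-- `rowOf 0` of the root `(0, 1)` vanishes. [folklore] -/
theorem rowOf_root_eq : rowOf 0 ((0, 1) : HexVertex) = 0 := by
  rw [rowOf_zero]; simp

/-- The gate edge `(0, 1) ∼ (e₁, 0)` is an edge of the honeycomb lattice. [folklore] -/
theorem adj_root_gate : hexGraph.Adj ((0, 1) : HexVertex) ((Pi.single 1 1, 0) : HexVertex) := by
  rw [hexGraph.adj_comm, hexGraph_adj_iff_of_snd_eq_zero_holds]
  simp

/-! ### Numerics of the rescaled witness (mesh `δ = 1/10`) -/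

/-- Real part of the rescaled gate vertex. [folklore] -/
theorem scaled_gate_re :
    (((1 / 10 : ℝ) : ℂ) * hexCenter ((Pi.single 1 1, 0) : HexVertex)).re = 1 / 10 := by
  rw [Complex.re_ofReal_mul, hexCenter_re]; simp; norm_num

/-- Imaginary part of the rescaled gate vertex. [folklore] -/
theorem scaled_gate_im :
    (((1 / 10 : ℝ) : ℂ) * hexCenter ((Pi.single 1 1, 0) : HexVertex)).im =
      1 / 10 * (2 * Real.sqrt 3 / 3) := by
  rw [Complex.im_ofReal_mul, hexCenter_im]; simp; ring

/-- Real part of the rescaled root. [folklore] -/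
theorem scaled_root_re : (((1 / 10 : ℝ) : ℂ) * hexCenter ((0, 1) : HexVertex)).re = 1 / 10 := by
  rw [Complex.re_ofReal_mul, hexCenter_re]; simp

/-- Imaginary part of the rescaled root. [folklore] -/
theorem scaled_root_im :
    (((1 / 10 : ℝ) : ℂ) * hexCenter ((0, 1) : HexVertex)).im = 1 / 10 * (Real.sqrt 3 / 3) := by
  rw [Complex.im_ofReal_mul, hexCenter_im]; simp; ring

/-- Rescaled vertices of the lower half-lattice `{rowOf 0 · ≤ 0}` lie weakly below the height of the
rescaled root. [folklore] -/
theorem scaled_im_le_of_rowOf_le {v : HexVertex} (h : rowOf 0 v ≤ rowOf 0 ((0, 1) : HexVertex)) :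
    (((1 / 10 : ℝ) : ℂ) * hexCenter v).im ≤ 1 / 10 * (Real.sqrt 3 / 3) := by
  rw [rowOf_root_eq] at h
  obtain ⟨x, t⟩ := v
  rw [rowOf_zero] at h
  rw [Complex.im_ofReal_mul, hexCenter_im]
  have hx : (x 1 : ℝ) ≤ 0 := by exact_mod_cast h
  have ht : ((t : ℕ) : ℝ) ≤ 1 := by exact_mod_cast Nat.lt_succ_iff.mp t.is_lt
  have h3 : 0 < Real.sqrt 3 := Real.sqrt_pos.mpr (by norm_num)
  nlinarith

/-- The rescaled gate vertex has norm `≤ 7/30`. [folklore] -/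
theorem norm_scaled_gate_le : ‖((1 / 10 : ℝ) : ℂ) * hexCenter ((Pi.single 1 1, 0) : HexVertex)‖ ≤ 7 / 30 := by
  refine (Complex.norm_le_abs_re_add_abs_im _).trans ?_
  rw [scaled_gate_re, scaled_gate_im]
  have h3 : Real.sqrt 3 < 2 := by rw [Real.sqrt_lt' (by norm_num : (0 : ℝ) < 2)]; norm_num
  have h3' : 0 < Real.sqrt 3 := Real.sqrt_pos.mpr (by norm_num)
  rw [abs_of_pos (by norm_num : (0 : ℝ) < 1 / 10), abs_of_pos (by positivity)]
  nlinarith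

/-- The rescaled root has norm `< 2` (the hypothesis of `not_wideEscape_of_subset_ball`). [folklore] -/
theorem norm_scaled_root_lt : ‖((1 / 10 : ℝ) : ℂ) * hexCenter ((0, 1) : HexVertex)‖ < 2 := by
  refine (Complex.norm_le_abs_re_add_abs_im _).trans_lt ?_
  rw [scaled_root_re, scaled_root_im]
  have h3 : Real.sqrt 3 < 2 := by rw [Real.sqrt_lt' (by norm_num : (0 : ℝ) < 2)]; norm_num
  have h3' : 0 < Real.sqrt 3 := Real.sqrt_pos.mpr (by norm_num)
  rw [abs_of_pos (by norm_num : (0 : ℝ) < 1 / 10), abs_of_pos (by positivity)]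
  nlinarith

/-- The rescaled gate edge is shorter than the window radius: `dist (δ c_p) (δ c_q) < 1/10`. [folklore] -/
theorem dist_root_gate_lt :
    dist (((1 / 10 : ℝ) : ℂ) * hexCenter ((0, 1) : HexVertex))
      (((1 / 10 : ℝ) : ℂ) * hexCenter ((Pi.single 1 1, 0) : HexVertex)) < 1 / 10 := by
  rw [dist_eq_norm]
  refine (Complex.norm_le_abs_re_add_abs_im _).trans_lt ?_
  rw [Complex.sub_re, Complex.sub_im, scaled_root_re, scaled_root_im, scaled_gate_re, scaled_gate_im]
  have h3 : Real.sqrt 3 < 2 := by rw [Real.sqrt_lt' (by norm_num : (0 : ℝ) < 2)]; norm_num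
  have h3' : 0 < Real.sqrt 3 := Real.sqrt_pos.mpr (by norm_num)
  rw [sub_self, abs_zero, zero_add, abs_sub_comm, abs_of_nonneg (by nlinarith)]
  nlinarith

/-- The closed window ball of radius `1/10` about the rescaled gate vertex lies in the unit disc.
[folklore] -/
theorem closedBall_gate_subset :
    closedBall (((1 / 10 : ℝ) : ℂ) * hexCenter ((Pi.single 1 1, 0) : HexVertex)) (1 / 10) ⊆
      ball (0 : ℂ) 1 := by
  intro z hz
  rw [mem_closedBall] at hz
  rw [mem_ball_zero_iff]
  have hQ := norm_scaled_gate_le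
  linarith [dist_triangle z (((1 / 10 : ℝ) : ℂ) * hexCenter ((Pi.single 1 1, 0) : HexVertex)) 0,
    dist_zero_right z,
    dist_zero_right (((1 / 10 : ℝ) : ℂ) * hexCenter ((Pi.single 1 1, 0) : HexVertex))]

/-! ### The vertical escape segment -/

/-- Real part along a vertical segment. [folklore] -/
theorem segment_vertical_re (Q : ℂ) (a b : ℝ) (t : unitInterval) :
    (Path.segment (Q + Complex.I * a) (Q + Complex.I * b) t).re = Q.re := by
  rw [Path.segment_apply, AffineMap.lineMap_apply_module']
  simp

/-- Imaginary part along a vertical segment. [folklore] -/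
theorem segment_vertical_im (Q : ℂ) (a b : ℝ) (t : unitInterval) :
    (Path.segment (Q + Complex.I * a) (Q + Complex.I * b) t).im = Q.im + a + (t : ℝ) * (b - a) := by
  rw [Path.segment_apply, AffineMap.lineMap_apply_module']
  simp; ring

/-- **The wide escape of the witness.**  For every removed set inside the lower half-lattice
`{rowOf 0 · ≤ rowOf 0 p}`, the vertical segment from `δ c_q + i/10` to `δ c_q + 2i/5` is a
`ρ/4`-wide escape in `𝔻` (`δ = ρ = 1/10`, `R = 1/5`, root `p = (0, 1)`, gate vertex `q = (e₁, 0)`):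
its closed `ρ/4`-balls stay in `𝔻` and at height `≥ ρ` above every rescaled vertex of the
half-lattice, and it ends at height `≥ 2R` above the rescaled root. [folklore] -/
theorem wideEscape_witness (S : Set HexVertex) (hS : ∀ v ∈ S, rowOf 0 v ≤ rowOf 0 ((0, 1) : HexVertex)) :
    WideEscape (ball (0 : ℂ) 1) (1 / 10) (1 / 10) (1 / 5) S ((0, 1) : HexVertex)
      ((Pi.single 1 1, 0) : HexVertex) := by
  have h3 : Real.sqrt 3 < 2 := by rw [Real.sqrt_lt' (by norm_num : (0 : ℝ) < 2)]; norm_num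
  have h3' : 0 < Real.sqrt 3 := Real.sqrt_pos.mpr (by norm_num)
  refine ⟨((1 / 10 : ℝ) : ℂ) * hexCenter ((Pi.single 1 1, 0) : HexVertex) + Complex.I * (1 / 10 : ℝ),
    ((1 / 10 : ℝ) : ℂ) * hexCenter ((Pi.single 1 1, 0) : HexVertex) + Complex.I * (2 / 5 : ℝ),
    Path.segment _ _, ?_, ?_, fun t => ⟨?_, ?_⟩⟩
  · -- the start is within `ρ` of the rescaled gate vertex
    rw [dist_eq_norm, add_sub_cancel_left, norm_mul, Complex.norm_I, one_mul, Complex.norm_real,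
      Real.norm_eq_abs, abs_of_pos (by norm_num : (0 : ℝ) < 1 / 10)]
  · -- the end is at distance `≥ 2R` from the rescaled root
    rw [dist_eq_norm]
    refine le_trans ?_ ((le_abs_self _).trans (Complex.abs_im_le_norm _))
    rw [Complex.sub_im, Complex.add_im, scaled_gate_im, scaled_root_im]
    simp only [Complex.mul_im, Complex.I_re, Complex.I_im, Complex.ofReal_re, Complex.ofReal_im]
    nlinarith
  · -- closed `ρ/4`-balls along the segment stay in the unit disc
    intro z hz
    rw [mem_closedBall] at hz
    rw [mem_ball_zero_iff]
    have hγ : ‖Path.segment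
        (((1 / 10 : ℝ) : ℂ) * hexCenter ((Pi.single 1 1, 0) : HexVertex) + Complex.I * (1 / 10 : ℝ))
        (((1 / 10 : ℝ) : ℂ) * hexCenter ((Pi.single 1 1, 0) : HexVertex) + Complex.I * (2 / 5 : ℝ))
        t‖ ≤ 7 / 30 + 2 / 5 := by
      refine (Complex.norm_le_abs_re_add_abs_im _).trans ?_
      rw [segment_vertical_re, segment_vertical_im, scaled_gate_re, scaled_gate_im]
      have ht0 : (0 : ℝ) ≤ (t : ℝ) := t.2.1
      have ht1 : (t : ℝ) ≤ 1 := t.2.2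
      rw [abs_of_pos (by norm_num : (0 : ℝ) < 1 / 10), abs_of_nonneg (by nlinarith)]
      nlinarith
    linarith [dist_triangle z (Path.segment
        (((1 / 10 : ℝ) : ℂ) * hexCenter ((Pi.single 1 1, 0) : HexVertex) + Complex.I * (1 / 10 : ℝ))
        (((1 / 10 : ℝ) : ℂ) * hexCenter ((Pi.single 1 1, 0) : HexVertex) + Complex.I * (2 / 5 : ℝ))
        t) 0,
      dist_zero_right z,
      dist_zero_right (Path.segment
        (((1 / 10 : ℝ) : ℂ) * hexCenter ((Pi.single 1 1, 0) : HexVertex) + Complex.I * (1 / 10 : ℝ))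
        (((1 / 10 : ℝ) : ℂ) * hexCenter ((Pi.single 1 1, 0) : HexVertex) + Complex.I * (2 / 5 : ℝ))
        t)]
  · -- the segment stays `ρ/4` above every rescaled vertex of the lower half-lattice
    intro v hv
    have hvim := scaled_im_le_of_rowOf_le (hS v hv)
    rw [dist_eq_norm]
    refine le_trans ?_ ((le_abs_self _).trans (Complex.abs_im_le_norm _))
    rw [Complex.sub_im, segment_vertical_im, scaled_gate_im]
    have ht0 : (0 : ℝ) ≤ (t : ℝ) := t.2.1
    nlinarith

/-- **A clean window of the witness edge**: if inside the window ball membership in `S` is the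
half-lattice condition `rowOf 0 · ≤ rowOf 0 p` (the removed set of `goodGate_nonvacuous` satisfies
this by definition), then `(p, q)` carries a clean flat `1/10`-window in `𝔻` in orientation `0`.
[folklore] -/
theorem hasCleanWindow_witness (S : Set HexVertex)
    (hwin : ∀ x : HexVertex, ((1 / 10 : ℝ) : ℂ) * hexCenter x ∈
        ball (((1 / 10 : ℝ) : ℂ) * hexCenter ((Pi.single 1 1, 0) : HexVertex)) (1 / 10) →
      (x ∈ S ↔ rowOf 0 x ≤ rowOf 0 ((0, 1) : HexVertex))) :
    HasCleanWindow (ball (0 : ℂ) 1) (1 / 10) (1 / 10) S ((0, 1) : HexVertex)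
      ((Pi.single 1 1, 0) : HexVertex) :=
  ⟨closedBall_gate_subset, 0, rowOf_gate_eq, hwin⟩

/-- **The first good gate of the witness**: if the root `p` lies in `S`, the gate vertex `q` does not,
`S` lies in the lower half-lattice and `(p, q)` carries a clean window w.r.t. `S`, then the two-step
list `[p, q]` has its first good gate at level `0` of the constant family `fun _ => S` (first exit at
index `1` through `{p, q}`, no return, clean window, wide escape; level `0` is trivially minimal).
[folklore] -/
theorem isFirstGoodGateN_witness (S : Set HexVertex) (hp : ((0, 1) : HexVertex) ∈ S)
    (hq : ((Pi.single 1 1, 0) : HexVertex) ∉ S)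
    (hS : ∀ v ∈ S, rowOf 0 v ≤ rowOf 0 ((0, 1) : HexVertex))
    (hW : HasCleanWindow (ball (0 : ℂ) 1) (1 / 10) (1 / 10) S ((0, 1) : HexVertex)
      ((Pi.single 1 1, 0) : HexVertex)) :
    IsFirstGoodGateN (ball (0 : ℂ) 1) (1 / 10) (1 / 10) (1 / 5) (fun _ => S) ((0, 1) : HexVertex)
      [((0, 1) : HexVertex), ((Pi.single 1 1, 0) : HexVertex)] 0 1 ((0, 1) : HexVertex)
      ((Pi.single 1 1, 0) : HexVertex) := by
  refine ⟨⟨⟨rfl, rfl, ?_, hq⟩, ?_, hW, wideEscape_witness S hS⟩, fun n' _ _ _ _ => Nat.zero_le _⟩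
  · intro v hv
    simp only [List.take_succ_cons, List.take_zero, List.mem_singleton] at hv
    rw [hv]
    exact hp
  · intro v hv
    simp only [List.drop_succ_cons, List.drop_zero, List.mem_singleton] at hv
    rw [hv]
    exact hq

/-! ### The certificates -/

/-- **GOOD GATES EXIST AT SMALL LOCALITY SCALE (non-vacuity of the r3 gate vocabulary; registered
helper `goodGate_nonvacuous`).**  In a domain `Ω ⊆ 𝔻` (here `Ω = 𝔻`), at a positive mesh, with a
rescaled root of norm `< 2` — exactly the setting in which `not_wideEscape_of_subset_ball` forbids wide
escapes for `R ≥ 2` — there ARE, for the small locality scale `R = 1/5`: a removed set `S ∋ c` inside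
the closed `R`-ball about the rescaled root (the locality clause of `TameNestedFamily`), a honeycomb
gate EDGE `(p, q)` out of it carrying a clean flat `ρ`-window AND a `ρ/4`-wide escape to distance `2R`,
so that the list `[p, q]` has a first good gate at level `0` of the constant family.  Witness:
`δ = ρ = 1/10`, `c = p = (0, 1)`, `q = (e₁, 0)`, `S =` the lower half-lattice `{rowOf 0 · ≤ rowOf 0 p}`
cut down to the window ball, escape = vertical segment. [folklore] -/
theorem goodGate_nonvacuous :
    ∃ (Ω : Set ℂ) (δ ρ R : ℝ) (S : Set HexVertex) (c p q : HexVertex),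
      0 < δ ∧ 0 < ρ ∧ 0 < R ∧ Ω ⊆ Metric.ball (0 : ℂ) 1 ∧ ‖(δ : ℂ) * hexCenter c‖ < 2 ∧ c ∈ S ∧
      (∀ v ∈ S, dist ((δ : ℂ) * hexCenter v) ((δ : ℂ) * hexCenter c) ≤ R) ∧
      hexGraph.Adj p q ∧ HasCleanWindow Ω δ ρ S p q ∧ WideEscape Ω δ ρ R S c q ∧
      IsFirstGoodGateN Ω δ ρ R (fun _ => S) c [p, q] 0 1 p q := by
  -- the removed set: lower half-lattice cut down to the window ball
  set S : Set HexVertex := {x | rowOf 0 x ≤ rowOf 0 ((0, 1) : HexVertex) ∧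
    ((1 / 10 : ℝ) : ℂ) * hexCenter x ∈
      ball (((1 / 10 : ℝ) : ℂ) * hexCenter ((Pi.single 1 1, 0) : HexVertex)) (1 / 10)} with hSdef
  have hS : ∀ v ∈ S, rowOf 0 v ≤ rowOf 0 ((0, 1) : HexVertex) := fun v hv => hv.1
  have hp : ((0, 1) : HexVertex) ∈ S := ⟨le_rfl, mem_ball.mpr dist_root_gate_lt⟩
  have hq : ((Pi.single 1 1, 0) : HexVertex) ∉ S := by
    intro h
    have h1 := h.1
    rw [rowOf_gate_eq] at h1
    omega
  have hW : HasCleanWindow (ball (0 : ℂ) 1) (1 / 10) (1 / 10) S ((0, 1) : HexVertex)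
      ((Pi.single 1 1, 0) : HexVertex) :=
    hasCleanWindow_witness S fun x hx => ⟨fun h => h.1, fun h => ⟨h, hx⟩⟩
  have hloc : ∀ v ∈ S, dist (((1 / 10 : ℝ) : ℂ) * hexCenter v)
      (((1 / 10 : ℝ) : ℂ) * hexCenter ((0, 1) : HexVertex)) ≤ 1 / 5 := by
    intro v hv
    have h1 : dist (((1 / 10 : ℝ) : ℂ) * hexCenter v)
        (((1 / 10 : ℝ) : ℂ) * hexCenter ((Pi.single 1 1, 0) : HexVertex)) < 1 / 10 :=
      mem_ball.mp hv.2
    have h2 := dist_root_gate_lt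
    rw [dist_comm] at h2
    linarith [dist_triangle (((1 / 10 : ℝ) : ℂ) * hexCenter v)
      (((1 / 10 : ℝ) : ℂ) * hexCenter ((Pi.single 1 1, 0) : HexVertex))
      (((1 / 10 : ℝ) : ℂ) * hexCenter ((0, 1) : HexVertex))]
  exact ⟨ball 0 1, 1 / 10, 1 / 10, 1 / 5, S, (0, 1), (0, 1), (Pi.single 1 1, 0), by norm_num,
    by norm_num, by norm_num, Subset.rfl, norm_scaled_root_lt, hp, hloc, adj_root_gate, hW,
    wideEscape_witness S hS, isFirstGoodGateN_witness S hp hq hS hW⟩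

/-- **Form (A) of the brief: `WideEscape` is satisfiable in a bounded domain** (with positive mesh,
window radius and locality scale). [folklore] -/
theorem wideEscape_nonvacuous :
    ∃ (Ω : Set ℂ) (δ ρ R : ℝ) (S : Set HexVertex) (c q : HexVertex),
      0 < δ ∧ 0 < ρ ∧ 0 < R ∧ Bornology.IsBounded Ω ∧ WideEscape Ω δ ρ R S c q := by
  obtain ⟨Ω, δ, ρ, R, S, c, p, q, hδ, hρ, hR, hΩ, -, -, -, -, -, hE, -⟩ := goodGate_nonvacuous
  exact ⟨Ω, δ, ρ, R, S, c, q, hδ, hρ, hR, isBounded_ball.subset hΩ, hE⟩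

/-- **Form (B) of the brief: a clean window AND a wide escape at one honeycomb gate edge of a bounded
domain, the root in the removed set, hence a good renewal (`GoodRenewalAtN`) of `[p, q]` for the
constant family.** [folklore] -/
theorem cleanWindow_wideEscape_nonvacuous :
    ∃ (Ω : Set ℂ) (δ ρ R : ℝ) (S : Set HexVertex) (c p q : HexVertex),
      0 < δ ∧ 0 < ρ ∧ 0 < R ∧ Bornology.IsBounded Ω ∧ c ∈ S ∧ hexGraph.Adj p q ∧
      HasCleanWindow Ω δ ρ S p q ∧ WideEscape Ω δ ρ R S c q ∧
      GoodRenewalAtN Ω δ ρ R (fun _ => S) c [p, q] := by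
  obtain ⟨Ω, δ, ρ, R, S, c, p, q, hδ, hρ, hR, hΩ, -, hc, -, hadj, hW, hE, hG⟩ := goodGate_nonvacuous
  exact ⟨Ω, δ, ρ, R, S, c, p, q, hδ, hρ, hR, isBounded_ball.subset hΩ, hc, hadj, hW, hE,
    0, 1, p, q, hG.1⟩

end Summit.CriticalPhenomena.SAWScalingLimit.Theorems.ObservableToSLE.TypeLadder

end
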